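import Summits.Ventures.YMGap.FlowData.KWeightTailOperator

/-!
# Venture YMGap, track Y3 FLOW-DATA — TAIL-A AT OPERATOR LEVEL, level 0 (file 2/2): the kept BLOCK's top eigenvalue,
# `λ↓₀(G) ≤ ‖T‖ ≤ λ↓₀(G) + κ‖A‖²`, the SECTOR version `‖T ∘ Q‖`, and the row arithmetic of `E = log ‖T‖ − log ‖T ∘ P‖`

HONEST FRAMING: venture file of the cell `pub-ymgap` (QuantumFields programme), track Y3, lineage A (seat flow-eng-1).
Abstract operator theory on a real inner-product space plus finite real linear algebra; NO lattice object, no number,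
no row, nothing about limits or a mass gap.

File 1/2 (`KWeightTailOperator`) proved the certificate forms: for a bounded symmetric `T` whose form factors as
`⟪x, T x⟫ = ⟪A x, 𝒦 (A x)⟫` through a positive `𝒦` diagonal on a finite orthonormal kept family `f_i` (`𝒦 f_i = q_i f_i`)
with dropped weights `≤ κ` (`⟪z, 𝒦 z⟫ ≤ κ‖z‖²` for `z ⊥` all `f_i`), `⟪g_i, ·⟫ = ⟪f_i, A ·⟫`, and the kept Galerkin block
`G_ij = √q_i √q_j ⟪g_i, g_j⟫`: a PSD test `cᵀGc ≤ μ cᵀc` gives `‖T‖ ≤ μ + κ‖A‖²`, a Ritz witness `σ cᵀc ≤ cᵀGc` gives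
`σ ≤ ‖T‖`.  Here:

* §4 the interface to the typed block certificates (`RitzDeflation.block_enclosure` encloses Mathlib's antitone
  `Matrix.IsHermitian.eigenvalues₀` of the kept block): `isHermitian_galerkin`; the two matrix-side Rayleigh facts
  `dotProduct_mulVec_le_eigenvalues₀_zero` (`cᵀGc ≤ λ↓₀ cᵀc`) and `exists_eigenvalues₀_mul_le_dotProduct_mulVec`
  (every `λ↓_k` is a Ritz value) from the tree's `CourantFischerBounds`; **`eigenvalues₀_le_norm`** (every
  `λ↓_k(G) ≤ ‖T‖`), **`norm_le_eigenvalues₀_zero_add`**, **`norm_mem_Icc`** —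
  `λ↓₀(G) ≤ ‖T‖ ≤ λ↓₀(G) + κ‖A‖²`, the operator-level form of `KWeightTail.eigenvalues₀_mem_Icc` at level `0`
  (`κ‖A‖² = κ_T Ω` there) — and `norm_mem_Icc_of_block` (`lo ≤ λ↓₀(G) ≤ hi ⇒ lo ≤ ‖T‖ ≤ hi + κ‖A‖²`);
* §5 SECTORS: for a symmetric idempotent `Q` commuting with `T` — the shape of every typed sector quantity
  (`TorelonEnergy.sectorNorm T C e = ‖T ∘ P_e‖`; a flux / momentum / point-group projection commutes with BOTH factors
  `A`, `𝒦` of the tube operator, so `T ∘ Q` factors through `A ∘ Q`): `isSymmetric_comp_of_commute`,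
  `inner_comp_apply_eq` (`⟪x, TQx⟫ = ⟪Qx, TQx⟫`), `inner_comp_factor`, **`norm_comp_mem_Icc`** —
  `λ↓₀(G^Q) ≤ ‖T ∘ Q‖ ≤ λ↓₀(G^Q) + κ‖A ∘ Q‖²` with `G^Q` the kept Galerkin block of the sector
  (`⟪g_i, ·⟫ = ⟪f_i, A (Q ·)⟫`); and `log_norm_sub_log_norm_mem_Icc` — the endpoint arithmetic of a flux energy
  `log ‖T‖ − log ‖T ∘ P_e‖` from the two windows (cf. `RitzDeflation.row_enclosure`).

WHAT IS NOT HERE (as in file 1/2): levels `k ≥ 1`; the identification of `A`, `𝒦`, `f_i`, `q_i`, `κ` for the tube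
transfer operator (character calculus of `LinkWeightExpansion` / `LinkCharacterBessel`); numbers.

References: R. A. Horn, C. R. Johnson, *Matrix Analysis*, 2nd ed. (2013), Thm. 4.2.2 / 4.2.6 (Rayleigh quotient,
Courant–Fischer), Thm. 4.3.1 (Weyl) [cite: HornJohnson2013, Thm 4.2.2; Thm 4.2.6; Thm 4.3.1]; the cell's FLOW-REFEREE.md
FR-18 and HOME/pub-ymgap-flow-eng-1/ENGINE.md §3 (i), §8 (iv) (2026-08-22/25).
-/

noncomputable section

open scoped InnerProductSpace BigOperators
open Matrix Finset WithLp

namespace Summit.Ventures.YMGap.FlowData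

namespace KWeightTailOperator

open Literature.Analysis.InnerProduct

/-! ### §4 Eigenvalue forms: the interface `Matrix.IsHermitian.eigenvalues₀` of the kept Galerkin block -/

section Eigenvalue

variable {E F : Type*} [NormedAddCommGroup E] [InnerProductSpace ℝ E] [NormedAddCommGroup F]
  [InnerProductSpace ℝ F] {ι : Type*} [Fintype ι] [DecidableEq ι]
  {T : E →L[ℝ] E} {A : E →L[ℝ] F} {𝒦 : F →L[ℝ] F} {f : ι → F} {q : ι → ℝ} {g : ι → E} {G : Matrix ι ι ℝ}

omit [Fintype ι] [DecidableEq ι] in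
/-- The kept Galerkin block `G_ij = √q_i √q_j ⟪g_i, g_j⟫` is real symmetric. [folklore] -/
theorem isHermitian_galerkin (hG : ∀ i j, G i j = √(q i) * √(q j) * ⟪g i, g j⟫_ℝ) : G.IsHermitian := by
  refine Matrix.IsHermitian.ext fun i j => ?_
  rw [star_trivial, hG, hG, real_inner_comm (g i) (g j)]
  ring

/-- The quadratic form of a real symmetric matrix is at most `λ↓₀ ·‖c‖²` (top of Mathlib's antitone enumeration;
Courant–Fischer, tree `re_inner_apply_self_le_of_inner_eq_zero` at level `0`). [cite: HornJohnson2013, Thm 4.2.2] -/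
theorem dotProduct_mulVec_le_eigenvalues₀_zero (hGh : G.IsHermitian) (h0 : 0 < Fintype.card ι) (c : ι → ℝ) :
    c ⬝ᵥ (G *ᵥ c) ≤ hGh.eigenvalues₀ ⟨0, h0⟩ * (c ⬝ᵥ c) := by
  have hS : (toEuclideanLin G).IsSymmetric := isSymmetric_toEuclideanLin_iff.mpr hGh
  have h := re_inner_apply_self_le_of_inner_eq_zero hS finrank_euclideanSpace ⟨0, h0⟩
    (x := toLp 2 c) (fun i hi => absurd hi (Nat.not_lt_zero _))
  rw [RCLike.re_to_real, real_inner_comm, inner_self_toEuclideanLin] at h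
  simp only [star_trivial, EuclideanSpace.norm_sq_eq, Real.norm_eq_abs, sq_abs] at h
  change c ⬝ᵥ (G *ᵥ c) ≤ hGh.eigenvalues₀ ⟨0, h0⟩ * ∑ i, c i ^ 2 at h
  have hcc : c ⬝ᵥ c = ∑ i, c i ^ 2 := by
    rw [dotProduct]; exact Finset.sum_congr rfl fun i _ => (sq (c i)).symm
  rwa [hcc]

/-- Every eigenvalue `λ↓_k` of a real symmetric matrix is a Ritz value: some `c ≠ 0` has `λ↓_k ‖c‖² ≤ cᵀ G c`
(Courant–Fischer, tree `exists_mem_eigenvalues_mul_le_re_inner` with the whole space as trial subspace).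
[cite: HornJohnson2013, Thm 4.2.2] -/
theorem exists_eigenvalues₀_mul_le_dotProduct_mulVec (hGh : G.IsHermitian) (k : Fin (Fintype.card ι)) :
    ∃ c : ι → ℝ, 0 < c ⬝ᵥ c ∧ hGh.eigenvalues₀ k * (c ⬝ᵥ c) ≤ c ⬝ᵥ (G *ᵥ c) := by
  have hS : (toEuclideanLin G).IsSymmetric := isSymmetric_toEuclideanLin_iff.mpr hGh
  obtain ⟨x, -, hx0, hx⟩ := exists_mem_eigenvalues_mul_le_re_inner hS finrank_euclideanSpace k ⊤
    (by rw [finrank_top, finrank_euclideanSpace]; exact Nat.le_add_right _ _)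
  refine ⟨ofLp x, ?_, ?_⟩
  · have hn : 0 < ‖x‖ ^ 2 := by positivity
    rw [EuclideanSpace.norm_sq_eq] at hn
    rw [dotProduct]
    refine lt_of_lt_of_le hn (le_of_eq (Finset.sum_congr rfl fun i _ => ?_))
    rw [Real.norm_eq_abs, sq_abs, sq]
  · rw [RCLike.re_to_real, real_inner_comm, inner_self_toEuclideanLin] at hx
    simp only [star_trivial, EuclideanSpace.norm_sq_eq, Real.norm_eq_abs, sq_abs] at hx
    change hGh.eigenvalues₀ k * ∑ i, (ofLp x) i ^ 2 ≤ (ofLp x) ⬝ᵥ (G *ᵥ ofLp x) at hx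
    have hcc : (ofLp x) ⬝ᵥ (ofLp x) = ∑ i, (ofLp x) i ^ 2 := by
      rw [dotProduct]; exact Finset.sum_congr rfl fun i _ => (sq _).symm
    rwa [hcc]

/-- **Every eigenvalue of the kept Galerkin block is below `‖T‖`**: `λ↓_k(G) ≤ ‖T‖` for all `k` (Rayleigh–Ritz on the
kept trial space; `T` need not be symmetric for this half). [cite: HornJohnson2013, Thm 4.2.2] -/
theorem eigenvalues₀_le_norm (hT : ∀ x, ⟪x, T x⟫_ℝ = ⟪A x, 𝒦 (A x)⟫_ℝ) (h𝒦 : 𝒦.IsPositive)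
    (hf : Orthonormal ℝ f) (hq : ∀ i, 𝒦 (f i) = q i • f i)
    (hg : ∀ i x, ⟪g i, x⟫_ℝ = ⟪f i, A x⟫_ℝ) (hG : ∀ i j, G i j = √(q i) * √(q j) * ⟪g i, g j⟫_ℝ)
    (k : Fin (Fintype.card ι)) : (isHermitian_galerkin hG).eigenvalues₀ k ≤ ‖T‖ := by
  obtain ⟨c, hc, hσ⟩ := exists_eigenvalues₀_mul_le_dotProduct_mulVec (isHermitian_galerkin hG) k
  exact le_norm_of_galerkin_witness hT h𝒦 hf hq hg hG hc hσ

/-- **`‖T‖ ≤ λ↓₀(G) + κ‖A‖²`** — the upper half of TAIL-A at operator level, with the exact top eigenvalue of the kept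
Galerkin block (non-empty kept set). [cite: HornJohnson2013, Thm 4.3.1] -/
theorem norm_le_eigenvalues₀_zero_add (hTsym : (T : E →ₗ[ℝ] E).IsSymmetric)
    (hT : ∀ x, ⟪x, T x⟫_ℝ = ⟪A x, 𝒦 (A x)⟫_ℝ) (h𝒦 : 𝒦.IsPositive)
    (hf : Orthonormal ℝ f) (hq : ∀ i, 𝒦 (f i) = q i • f i)
    {κ : ℝ} (hκ0 : 0 ≤ κ) (hκ : ∀ z : F, (∀ i, ⟪f i, z⟫_ℝ = 0) → ⟪z, 𝒦 z⟫_ℝ ≤ κ * ‖z‖ ^ 2)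
    (hg : ∀ i x, ⟪g i, x⟫_ℝ = ⟪f i, A x⟫_ℝ) (hG : ∀ i j, G i j = √(q i) * √(q j) * ⟪g i, g j⟫_ℝ)
    (h0 : 0 < Fintype.card ι) :
    ‖T‖ ≤ (isHermitian_galerkin hG).eigenvalues₀ ⟨0, h0⟩ + κ * ‖A‖ ^ 2 := by
  have hGh := isHermitian_galerkin hG
  -- `λ↓₀ ≥ 0`: the block is a Gram-type matrix, `cᵀGc = ‖Z c‖² ≥ 0`, tested at any `c ≠ 0`
  obtain ⟨c, hc, hle⟩ := exists_eigenvalues₀_mul_le_dotProduct_mulVec hGh ⟨0, h0⟩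
  have hμ0 : 0 ≤ hGh.eigenvalues₀ ⟨0, h0⟩ := by
    have hcc : 0 ≤ c ⬝ᵥ (G *ᵥ c) := by rw [← norm_sq_trial hG c]; positivity
    have h := dotProduct_mulVec_le_eigenvalues₀_zero hGh h0 c
    nlinarith
  exact norm_le_of_galerkin_bound hTsym hT h𝒦 hf hq hκ0 hκ hg hG hμ0
    (dotProduct_mulVec_le_eigenvalues₀_zero hGh h0)

/-- **TAIL-A AT OPERATOR LEVEL (level 0).**  `λ↓₀(G) ≤ ‖T‖ ≤ λ↓₀(G) + κ ‖A‖²` for a bounded symmetric `T` whose form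
factors as `⟪x, T x⟫ = ⟪A x, 𝒦 (A x)⟫` through a positive `𝒦` diagonal on a finite orthonormal kept family with dropped
weights `≤ κ`; `G` = the kept Galerkin block.  The operator-level form of `KWeightTail.eigenvalues₀_mem_Icc` at `k = 0`
(there `κ‖A‖² = κ_T Ω`). [cite: HornJohnson2013, Thm 4.3.1] -/
theorem norm_mem_Icc (hTsym : (T : E →ₗ[ℝ] E).IsSymmetric)
    (hT : ∀ x, ⟪x, T x⟫_ℝ = ⟪A x, 𝒦 (A x)⟫_ℝ) (h𝒦 : 𝒦.IsPositive)
    (hf : Orthonormal ℝ f) (hq : ∀ i, 𝒦 (f i) = q i • f i)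
    {κ : ℝ} (hκ0 : 0 ≤ κ) (hκ : ∀ z : F, (∀ i, ⟪f i, z⟫_ℝ = 0) → ⟪z, 𝒦 z⟫_ℝ ≤ κ * ‖z‖ ^ 2)
    (hg : ∀ i x, ⟪g i, x⟫_ℝ = ⟪f i, A x⟫_ℝ) (hG : ∀ i j, G i j = √(q i) * √(q j) * ⟪g i, g j⟫_ℝ)
    (h0 : 0 < Fintype.card ι) :
    ‖T‖ ∈ Set.Icc ((isHermitian_galerkin hG).eigenvalues₀ ⟨0, h0⟩)
      ((isHermitian_galerkin hG).eigenvalues₀ ⟨0, h0⟩ + κ * ‖A‖ ^ 2) :=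
  ⟨eigenvalues₀_le_norm hT h𝒦 hf hq hg hG _,
    norm_le_eigenvalues₀_zero_add hTsym hT h𝒦 hf hq hκ0 hκ hg hG h0⟩

/-- **With a block certificate.** If a certificate delivers `lo ≤ λ↓₀(G) ≤ hi` for the kept Galerkin block (e.g.
`RitzDeflation.block_enclosure` / `bracketed_block_enclosure`), then `lo ≤ ‖T‖ ≤ hi + κ‖A‖²`. [folklore] -/
theorem norm_mem_Icc_of_block (hTsym : (T : E →ₗ[ℝ] E).IsSymmetric)
    (hT : ∀ x, ⟪x, T x⟫_ℝ = ⟪A x, 𝒦 (A x)⟫_ℝ) (h𝒦 : 𝒦.IsPositive)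
    (hf : Orthonormal ℝ f) (hq : ∀ i, 𝒦 (f i) = q i • f i)
    {κ : ℝ} (hκ0 : 0 ≤ κ) (hκ : ∀ z : F, (∀ i, ⟪f i, z⟫_ℝ = 0) → ⟪z, 𝒦 z⟫_ℝ ≤ κ * ‖z‖ ^ 2)
    (hg : ∀ i x, ⟪g i, x⟫_ℝ = ⟪f i, A x⟫_ℝ) (hG : ∀ i j, G i j = √(q i) * √(q j) * ⟪g i, g j⟫_ℝ)
    (h0 : 0 < Fintype.card ι) {lo hi : ℝ}
    (hblock : lo ≤ (isHermitian_galerkin hG).eigenvalues₀ ⟨0, h0⟩ ∧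
      (isHermitian_galerkin hG).eigenvalues₀ ⟨0, h0⟩ ≤ hi) :
    ‖T‖ ∈ Set.Icc lo (hi + κ * ‖A‖ ^ 2) := by
  obtain ⟨h1, h2⟩ := norm_mem_Icc hTsym hT h𝒦 hf hq hκ0 hκ hg hG h0
  exact ⟨hblock.1.trans h1, h2.trans (by linarith [hblock.2])⟩

end Eigenvalue

/-! ### §5 Sectors: `T ∘ Q` for a symmetric idempotent `Q` commuting with `T`, and the row arithmetic -/

section Sector

variable {E F : Type*} [NormedAddCommGroup E] [InnerProductSpace ℝ E] [NormedAddCommGroup F]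
  [InnerProductSpace ℝ F] {ι : Type*} [Fintype ι] [DecidableEq ι]
  {T Q : E →L[ℝ] E} {A : E →L[ℝ] F} {𝒦 : F →L[ℝ] F} {f : ι → F} {q : ι → ℝ} {g : ι → E} {G : Matrix ι ι ℝ}

omit [Fintype ι] [DecidableEq ι] in
/-- `T ∘ Q` is symmetric when `T`, `Q` are symmetric and commute. [folklore] -/
theorem isSymmetric_comp_of_commute (hTsym : (T : E →ₗ[ℝ] E).IsSymmetric) (hQsym : (Q : E →ₗ[ℝ] E).IsSymmetric)
    (hQT : ∀ x, Q (T x) = T (Q x)) : ((T ∘L Q : E →L[ℝ] E) : E →ₗ[ℝ] E).IsSymmetric := by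
  intro x y
  have h1 := hQsym x (T y)
  have h2 := hTsym (Q x) y
  simp only [ContinuousLinearMap.coe_coe, ContinuousLinearMap.coe_comp, Function.comp_apply] at h1 h2 ⊢
  rw [h2, ← hQT y, h1]

omit [Fintype ι] [DecidableEq ι] in
/-- For a symmetric idempotent `Q` commuting with `T`: `⟪x, T (Q x)⟫ = ⟪Q x, T (Q x)⟫` (`T Q = Q T Q`). [folklore] -/
theorem inner_comp_apply_eq (hQsym : (Q : E →ₗ[ℝ] E).IsSymmetric) (hQ2 : ∀ x, Q (Q x) = Q x)
    (hQT : ∀ x, Q (T x) = T (Q x)) (x : E) : ⟪x, (T ∘L Q) x⟫_ℝ = ⟪Q x, T (Q x)⟫_ℝ := by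
  have h := hQsym x (T (Q x))
  simp only [ContinuousLinearMap.coe_coe] at h
  rw [ContinuousLinearMap.coe_comp, Function.comp_apply, h, hQT, hQ2]

omit [Fintype ι] [DecidableEq ι] in
/-- If the form of `T` factors through `A`, the form of `T ∘ Q` factors through `A ∘ Q`. [folklore] -/
theorem inner_comp_factor (hT : ∀ x, ⟪x, T x⟫_ℝ = ⟪A x, 𝒦 (A x)⟫_ℝ) (hQsym : (Q : E →ₗ[ℝ] E).IsSymmetric)
    (hQ2 : ∀ x, Q (Q x) = Q x) (hQT : ∀ x, Q (T x) = T (Q x)) (x : E) :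
    ⟪x, (T ∘L Q) x⟫_ℝ = ⟪(A ∘L Q) x, 𝒦 ((A ∘L Q) x)⟫_ℝ := by
  rw [inner_comp_apply_eq hQsym hQ2 hQT, hT]
  rfl

/-- **TAIL-A at operator level for a SECTOR TOP `‖T ∘ Q‖`** (`Q` a symmetric idempotent commuting with `T`: a flux /
momentum / point-group sector projection; the typed `TorelonEnergy.sectorNorm` has this shape): with the kept data of
`T` and `⟪g_i, ·⟫ = ⟪f_i, A (Q ·)⟫`, `G^Q_ij = √q_i √q_j ⟪g_i, g_j⟫` (the kept Galerkin block OF THE SECTOR),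
`λ↓₀(G^Q) ≤ ‖T ∘ Q‖ ≤ λ↓₀(G^Q) + κ ‖A ∘ Q‖²`. [cite: HornJohnson2013, Thm 4.3.1] -/
theorem norm_comp_mem_Icc (hTsym : (T : E →ₗ[ℝ] E).IsSymmetric)
    (hT : ∀ x, ⟪x, T x⟫_ℝ = ⟪A x, 𝒦 (A x)⟫_ℝ) (h𝒦 : 𝒦.IsPositive)
    (hQsym : (Q : E →ₗ[ℝ] E).IsSymmetric) (hQ2 : ∀ x, Q (Q x) = Q x) (hQT : ∀ x, Q (T x) = T (Q x))
    (hf : Orthonormal ℝ f) (hq : ∀ i, 𝒦 (f i) = q i • f i)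
    {κ : ℝ} (hκ0 : 0 ≤ κ) (hκ : ∀ z : F, (∀ i, ⟪f i, z⟫_ℝ = 0) → ⟪z, 𝒦 z⟫_ℝ ≤ κ * ‖z‖ ^ 2)
    (hg : ∀ i x, ⟪g i, x⟫_ℝ = ⟪f i, A (Q x)⟫_ℝ) (hG : ∀ i j, G i j = √(q i) * √(q j) * ⟪g i, g j⟫_ℝ)
    (h0 : 0 < Fintype.card ι) :
    ‖T ∘L Q‖ ∈ Set.Icc ((isHermitian_galerkin hG).eigenvalues₀ ⟨0, h0⟩)
      ((isHermitian_galerkin hG).eigenvalues₀ ⟨0, h0⟩ + κ * ‖A ∘L Q‖ ^ 2) :=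
  norm_mem_Icc (isSymmetric_comp_of_commute hTsym hQsym hQT) (inner_comp_factor hT hQsym hQ2 hQT) h𝒦 hf hq
    hκ0 hκ (fun i x => by rw [hg]; rfl) hG h0

omit [Fintype ι] [DecidableEq ι] in
/-- **Row arithmetic for a flux energy `E = log ‖T‖ − log ‖T'‖`** from the two windows (`T' = T ∘ P_e`):
`a ≤ ‖T‖ ≤ b`, `a' ≤ ‖T'‖ ≤ b'` with `a, a' > 0` give `log a − log b' ≤ log ‖T‖ − log ‖T'‖ ≤ log b − log a'`
(cf. `RitzDeflation.row_enclosure`). [folklore] -/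
theorem log_norm_sub_log_norm_mem_Icc {T' : E →L[ℝ] E} {a b a' b' : ℝ} (ha : 0 < a) (ha' : 0 < a')
    (hTab : ‖T‖ ∈ Set.Icc a b) (hT'ab : ‖T'‖ ∈ Set.Icc a' b') :
    Real.log ‖T‖ - Real.log ‖T'‖ ∈ Set.Icc (Real.log a - Real.log b') (Real.log b - Real.log a') := by
  have hT0 : 0 < ‖T‖ := ha.trans_le hTab.1
  have hT'0 : 0 < ‖T'‖ := ha'.trans_le hT'ab.1
  refine ⟨?_, ?_⟩
  · have h1 := Real.log_le_log ha hTab.1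
    have h2 := Real.log_le_log hT'0 hT'ab.2
    linarith
  · have h1 := Real.log_le_log hT0 hTab.2
    have h2 := Real.log_le_log ha' hT'ab.1
    linarith

end Sector

end KWeightTailOperator

end Summit.Ventures.YMGap.FlowData
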